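import Summits.BirchSwinnertonDyer.BirchSwinnertonDyer.Theses.InertBadSignedBranches
import HarnessLib

/-!
# Route `InertBadSignedBranches` (rung K8, rev 11) — the by-name glue item `PublishedFactsInertOfParts`
# (stmt-BirchSwinnertonDyer-19514) CLOSED

Planner bsd-cm-plan g16 (D95) split the support item `PublishedFactsInert` (19227: entire `L(E,s)` ∧
Gross–Zagier I.7.3 ∧ GZK ∧ Poitou–Tate over ℚ ∧ newform existence ∧ Mazur's `p ∤ c_Manin` at odd `p`) into
its six by-name parts (dedup'd existing fact items `EntireLFunctionRat`, `GrossZagierRationalPointI73`,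
`RankEqAnalyticRankLeOne`, `PublishedInputNewform`, `PublishedInputManinOdd`, `PoitouTateRealRat`) plus this
glue: parts ⟹ parent. The parts are, by definition, the parent's conjuncts; the proof is the anonymous
constructor in the parent's order (planner-checked draft HOME/bsd-cm-plan/g16/repair/K8/ClosingDrafts.lean;
filed by hand k8i-c2 g4). Nothing mathematical is asserted: an implication between the route's own items.
[cite: GrossZagier1986, Thm. I.(7.3)] [cite: Mazur1978, Cor. 4.1] [cite: MilneADT2006, Ch. I, Thm. 4.10]
-/

set_option linter.dupNamespace false

namespace Summit.BirchSwinnertonDyer.BirchSwinnertonDyer.Theorems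

open Summit.BirchSwinnertonDyer.BirchSwinnertonDyer.Theses.InertBadSignedBranches in
/-- **`PublishedFactsInertOfParts` holds** (stmt-BirchSwinnertonDyer-19514): the parent conjunction
`PublishedFactsInert` from its six by-name parts (parent order: entire `L` ∧ GZ I.7.3 ∧ GZK ∧ Poitou–Tate ∧
newform ∧ Manin-odd; the parts arrive in the order entire, GZ, GZK, newform, Manin, Poitou–Tate).
[cite: GrossZagier1986, Thm. I.(7.3)] [cite: Mazur1978, Cor. 4.1] -/
theorem inertBadSignedBranches_publishedFactsInertOfParts_proof : PublishedFactsInertOfParts :=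
  fun h₁ h₂ h₃ h₄ h₅ h₆ => ⟨h₁, h₂, h₃, h₆, h₄, h₅⟩

end Summit.BirchSwinnertonDyer.BirchSwinnertonDyer.Theorems
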